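import Mathlib
import Summits.Ventures.HodgeRepro2.HeckeSpectralReal

/-!
# HeckeEigenformBasisFunctions — «`S_k(Γ)` has a basis of Hecke eigenforms», at the level of
functions on the ball

Blind cell `pub-hodge-repro2`, seat p2 (Tier 5 kernel support, Hecke side).

`HeckeSpectralReal.lean` gives an orthonormal basis of the holomorphic part of the Petersson space
consisting of `T_δ`-eigenforms with real eigenvalues (under `δ⁻¹ ∈ SδS`). Read at the level of
functions on the ball (holomorphic representatives `holRep`, `HolomorphicFiniteDimensional.lean`,
and the identification `PeterssonSpace.mk_eq_mk_iff` of forms agreeing on the ball):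

* **`exists_finite_spanning_hecke_eigenforms`**: there are `n = finrank` holomorphic weight-`k`
  forms `g₁, …, g_n` for `S`, each a `T_δ`-eigenform with real eigenvalue (as a class), such that
  every holomorphic weight-`k` form for `S` agrees on the ball with a linear combination of them.
-/

namespace Summit.Ventures.HodgeRepro2.ShimuraData

open MeasureTheory

variable {K : Type*} [Field K] [NumberField K] [NumberField.IsCMField K] {τ₁ : K →+* ℂ}
  {H : Matrix (Fin 3) (Fin 3) K} {Q : Matrix (Fin 3) (Fin 3) ℂ} {𝔪 : Submodule ℤ (Fin 3 → K)}

/-- **A finite spanning family of holomorphic `T_δ`-eigenforms with real eigenvalues**, under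
`δ⁻¹ ∈ SδS`: every holomorphic weight-`k` form for `S` agrees on the ball with a linear combination
of the `n = finrank` eigenforms `g i`. -/
theorem exists_finite_spanning_hecke_eigenforms (hH : IsHermitianForm K H)
    (hdef : ∀ τ : K →+* ℂ, NumberField.InfinitePlace.mk τ ≠ NumberField.InfinitePlace.mk τ₁ →
      IsDefiniteAt K τ H)
    (hQ : IsFrame K τ₁ H Q) (h𝔪 : IsLattice K 𝔪) {N : ℕ} {S : Subgroup (GL (Fin 3) K)}
    (hS : (S : Set (GL (Fin 3) K)) ⊆ shimuraLevel K H 𝔪 N)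
    (hS₁ : S ≤ shimuraLevelSubgroup K H 𝔪 1)
    (hfin : (S.subgroupOf (shimuraLevelSubgroup K H 𝔪 1)).FiniteIndex)
    [CompactSpace (ballQuotient hQ S (subset_unitaryGroup_of_subset_shimuraLevel hS))]
    {D : Set ball₂} (k : ℕ)
    (hD : IsBallFundamentalDomain hQ S (subset_unitaryGroup_of_subset_shimuraLevel hS) D)
    (hDm : MeasurableSet D) (δ : unitaryGroup K H)
    (hmem : (δ : GL (Fin 3) K)⁻¹ ∈ doubleCoset S (δ : GL (Fin 3) K)) :
    ∃ (n : ℕ) (g : Fin n → PeterssonForms hQ S _ k hD),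
      (∀ i, g i ∈ holomorphicForms hQ S _ k hD) ∧
      (∀ i, ∃ r : ℝ, heckeFamilyOf hQ S _ k hD hDm
          (fun δ => fintypeHeckeQuotientOfFiniteIndex h𝔪 hS₁ hfin δ.2) δ
          (SeparationQuotient.mk (g i))
        = (r : ℂ) • (SeparationQuotient.mk (g i) : PeterssonSpace hQ S _ k hD)) ∧
      ∀ h ∈ holomorphicForms hQ S _ k hD, ∃ c : Fin n → ℂ, ∀ z ∈ ball₂,
        (PeterssonForms.toForm hQ S _ k hD h : (Fin 2 → ℂ) → ℂ) z
          = ∑ i, c i * (PeterssonForms.toForm hQ S _ k hD (g i) : (Fin 2 → ℂ) → ℂ) z := by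
  obtain ⟨b, hb⟩ := exists_orthonormalBasis_heckeSpace_holomorphic_real_of_inv_mem_doubleCoset
    hH hdef hQ h𝔪 hS hS₁ hfin k hD hDm δ hmem
  refine ⟨Module.finrank ℂ (holomorphicSpace hQ S _ k hD),
    fun i => holRep hQ S _ k hD (b i), fun i => holRep_mem hQ S _ k hD (b i), ?_, ?_⟩
  · intro i
    obtain ⟨r, hr⟩ := hb i
    refine ⟨r, ?_⟩
    rw [mk_holRep hQ S _ k hD (b i)]
    exact hr
  intro h hh
  set v : holomorphicSpace hQ S _ k hD :=
    ⟨SeparationQuotient.mk h, mk_mem_holomorphicSpace hQ S _ k hD hh⟩ with hvdef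
  refine ⟨fun i => b.repr v i, ?_⟩
  have hcoe : (v : PeterssonSpace hQ S _ k hD)
      = ∑ i, b.repr v i • (b i : PeterssonSpace hQ S _ k hD) := by
    conv_lhs => rw [← b.sum_repr v]
    simp only [Submodule.coe_sum, Submodule.coe_smul]
  have hmk : ∀ i, (b i : PeterssonSpace hQ S _ k hD)
      = SeparationQuotient.mk (holRep hQ S _ k hD (b i)) :=
    fun i => (mk_holRep hQ S _ k hD (b i)).symm
  have hmksum : (SeparationQuotient.mk (∑ i, b.repr v i • holRep hQ S _ k hD (b i)) :
      PeterssonSpace hQ S _ k hD)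
      = ∑ i, b.repr v i • (SeparationQuotient.mk (holRep hQ S _ k hD (b i)) :
          PeterssonSpace hQ S _ k hD) := by
    change (SeparationQuotient.mkCLM ℂ (PeterssonForms hQ S _ k hD))
        (∑ i, b.repr v i • holRep hQ S _ k hD (b i))
      = ∑ i, b.repr v i • (SeparationQuotient.mkCLM ℂ (PeterssonForms hQ S _ k hD))
          (holRep hQ S _ k hD (b i))
    simp only [map_sum, map_smul]
  have hsum : (SeparationQuotient.mk h : PeterssonSpace hQ S _ k hD)
      = SeparationQuotient.mk (∑ i, b.repr v i • holRep hQ S _ k hD (b i)) := by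
    have h1 : (v : PeterssonSpace hQ S _ k hD) = SeparationQuotient.mk h := rfl
    rw [← h1, hcoe, hmksum]
    simp only [hmk]
  rw [PeterssonSpace.mk_eq_mk_iff] at hsum
  intro z hz
  rw [hsum z hz]
  show ((∑ i, b.repr v i • holRep hQ S _ k hD (b i) : weightForms τ₁ Q S k) :
    (Fin 2 → ℂ) → ℂ) z = _
  simp only [Submodule.coe_sum, Finset.sum_apply]
  rfl

end Summit.Ventures.HodgeRepro2.ShimuraData
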